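import Mathlib
import Summits.Ventures.PercRepro2.HCov
import Summits.Ventures.PercRepro2.TypedSixVertex
import Summits.Ventures.PercRepro2.GcSkelReductionMinH
import Summits.Ventures.PercRepro2.GcInterior
import Summits.Ventures.PercRepro2.GcRational

/-!
# The six-vertex theorem folded into the weighted residual: one more clause, `6 < |V|`
(blind cell PercRepro2, typer-1 g55)

mine-2 g42's **`TypedRed.HCov_of_card_le_six`** (TypedSixVertex p702957): (HCOV) on every graph with
at most six vertices, every admissible weight and every five distinct marks. As a class theorem it
is one more clause of the class of record — on the vertex type rather than on `(ends, marks)`, so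
it sits in the closure rather than in the structure `WReducedMinH`:

* **`HCovWRedMinH7_all`** — (HCOV) on the class of record with `6 < Fintype.card V`;
  **`HCovWRedMinH7_int_all`** — the same at interior weights;
* **`HCov_all_iff_HCovWRedMinH7_all`**, **`HCov_all_iff_HCovWRedMinH7_int_all`** — the crux is
  (HCOV) on the class of record on at least seven vertices, at interior weights;
* **`HCov_all_real_iff_HCovWRedMinH7_int_all_rat`** — THE STATEMENT OF RECORD: the crux over `ℝ`
  is (HCOV) on the class of record on at least seven vertices at RATIONAL interior weights.

On the class of record a graph has at least one unmarked vertex (`a₃` has an unmarked neighbour,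
`¬R₃`), so `|V| ≥ 6` already; the new clause says the residual instances that matter have at
least TWO unmarked vertices — the engine's `n ≤ 6` census (0 / 161,280 at `n = 6`) is a theorem.
-/

namespace Summit.Ventures.PercRepro2

open CovForm

namespace WRed

section Closure

variable (R : Type*) [Field R] [LinearOrder R] [IsStrictOrderedRing R]

/-- **(HCOV) on the class of record on at least seven vertices.** -/
def HCovWRedMinH7_all : Prop :=
  ∀ (V E : Type) [Fintype V] [DecidableEq V] [Fintype E] [DecidableEq E]
    (ends : E → Sym2 V) (p : E → R), IsProbVec p → 6 < Fintype.card V →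
    ∀ o a₁ a₂ a₃ b : V, a₁ ≠ a₂ → a₁ ≠ a₃ → a₂ ≠ a₃ → o ≠ a₁ → o ≠ a₂ → o ≠ a₃ → o ≠ b →
      b ≠ a₁ → b ≠ a₂ → b ≠ a₃ → WReducedMinH ends o a₁ a₂ a₃ b → HCov p ends o a₁ a₂ a₃ b

/-- **(HCOV) on the class of record on at least seven vertices, at interior weights.** -/
def HCovWRedMinH7_int_all : Prop :=
  ∀ (V E : Type) [Fintype V] [DecidableEq V] [Fintype E] [DecidableEq E]
    (ends : E → Sym2 V) (p : E → R), IsIntVec p → 6 < Fintype.card V →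
    ∀ o a₁ a₂ a₃ b : V, a₁ ≠ a₂ → a₁ ≠ a₃ → a₂ ≠ a₃ → o ≠ a₁ → o ≠ a₂ → o ≠ a₃ → o ≠ b →
      b ≠ a₁ → b ≠ a₂ → b ≠ a₃ → WReducedMinH ends o a₁ a₂ a₃ b → HCov p ends o a₁ a₂ a₃ b

end Closure

section Main

variable {R : Type*} [Field R] [LinearOrder R] [IsStrictOrderedRing R]

/-- The seven-vertex closure gives the class-of-record closure: `by_cases` on `|V| ≤ 6`, the
small case by `HCov_of_card_le_six`. -/
theorem HCovWRedMinH_all_of_HCovWRedMinH7_all (h : HCovWRedMinH7_all R) : HCovWRedMinH_all R := by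
  intro V E _ _ _ _ ends p hp o a₁ a₂ a₃ b h12 h13 h23 ho1 ho2 ho3 hob hb1 hb2 hb3 hred
  by_cases hV : Fintype.card V ≤ 6
  · exact TypedRed.HCov_of_card_le_six ends p hp o a₁ a₂ a₃ b hV h12 h13 h23 ho1 ho2 ho3 hob hb1
      hb2 hb3
  · exact h V E ends p hp (not_le.1 hV) o a₁ a₂ a₃ b h12 h13 h23 ho1 ho2 ho3 hob hb1 hb2 hb3 hred

/-- The two closures agree (the converse drops the vertex bound). -/
theorem HCovWRedMinH_all_iff_HCovWRedMinH7_all : HCovWRedMinH_all R ↔ HCovWRedMinH7_all R :=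
  ⟨fun h V E _ _ _ _ ends p hp _ o a₁ a₂ a₃ b h12 h13 h23 ho1 ho2 ho3 hob hb1 hb2 hb3 hred =>
      h V E ends p hp o a₁ a₂ a₃ b h12 h13 h23 ho1 ho2 ho3 hob hb1 hb2 hb3 hred,
    HCovWRedMinH_all_of_HCovWRedMinH7_all⟩

/-- **THE CRUX ON THE CLASS OF RECORD ON AT LEAST SEVEN VERTICES**:
`HCov_all ↔ HCovWRedMinH7_all`. -/
theorem HCov_all_iff_HCovWRedMinH7_all : HCov_all R ↔ HCovWRedMinH7_all R :=
  HCov_all_iff_HCovWRedMinH_all.trans HCovWRedMinH_all_iff_HCovWRedMinH7_all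

/-- The interior closure on at least seven vertices gives the seven-vertex closure. -/
theorem HCovWRedMinH7_all_of_int (h : HCovWRedMinH7_int_all R) : HCovWRedMinH7_all R := by
  intro V E _ _ _ _ ends p hp hV o a₁ a₂ a₃ b h12 h13 h23 ho1 ho2 ho3 hob hb1 hb2 hb3 hred
  exact HCov_of_int ends o a₁ a₂ a₃ b
    (fun q hq => h V E ends q hq hV o a₁ a₂ a₃ b h12 h13 h23 ho1 ho2 ho3 hob hb1 hb2 hb3 hred) p hp

/-- The two seven-vertex closures agree. -/
theorem HCovWRedMinH7_all_iff_int : HCovWRedMinH7_all R ↔ HCovWRedMinH7_int_all R :=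
  ⟨fun h V E _ _ _ _ ends p hp hV o a₁ a₂ a₃ b h12 h13 h23 ho1 ho2 ho3 hob hb1 hb2 hb3 hred =>
      h V E ends p hp.isProbVec hV o a₁ a₂ a₃ b h12 h13 h23 ho1 ho2 ho3 hob hb1 hb2 hb3 hred,
    HCovWRedMinH7_all_of_int⟩

/-- **THE CRUX ON THE CLASS OF RECORD ON AT LEAST SEVEN VERTICES, AT INTERIOR WEIGHTS**:
`HCov_all ↔ HCovWRedMinH7_int_all`. -/
theorem HCov_all_iff_HCovWRedMinH7_int_all : HCov_all R ↔ HCovWRedMinH7_int_all R :=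
  HCov_all_iff_HCovWRedMinH7_all.trans HCovWRedMinH7_all_iff_int

end Main

section Real

/-- **THE STATEMENT OF RECORD**: the crux over `ℝ` is (HCOV) on the class of record on at least
seven vertices, at rational weights in `(0, 1)^E`. -/
theorem HCov_all_real_iff_HCovWRedMinH7_int_all_rat : HCov_all ℝ ↔ HCovWRedMinH7_int_all ℚ :=
  HCov_all_real_iff_rat.trans (HCov_all_iff_HCovWRedMinH7_int_all (R := ℚ))

end Real

end WRed

end Summit.Ventures.PercRepro2
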